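import Summits.CriticalPhenomena.CardyFormulaZ2.Theorems.CardyIKTransportIKLinearTransportLine
import Summits.CriticalPhenomena.CardyFormulaZ2.Theorems.CardyIKTransportIKQuarterTurnBijection

/-!
# Stub `stub_PinnedExchange` (line `pinned-diagram-exchange`, crux stmt-CriticalPhenomena-5076)

Closed helpers toward the exchange maps `IsExchangeKernel` (Fact 5.15 of arXiv:2502.08394 for the
IK family), discharging the CONSISTENCY conditions its clauses impose on the gauge `μIK`/`obs`:
`measurable_obs`; `nuMix_map_vshift` — vertical stationarity of `νmix S` ((i) vs the sure
covariance (iv)), by a `μIK`-preserving re-anchoring; `nuMix_symmDiff_apply_eq` — for adjacent face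
columns `i, i+1` of different type the laws of the observables OFF cell column `i+1` / face columns
`i, i+1` agree for `S` and `S ∆ {i,i+1}` ((i)+(ii)), by a `μIK`-preserving column swap.
-/

noncomputable section

namespace Summit.CriticalPhenomena.CardyFormulaZ2.Theorems.IKLinearTransport.PinnedDiagramExchange

open scoped BigOperators Topology Classical MeasureTheory ProbabilityTheory ENNReal symmDiff
open Filter Set Function MeasureTheory
open Literature.Probability.Percolation Literature.Probability.LatticeModels
open Summit.CriticalPhenomena.CardyFormulaZ2.Theorems.IKQuarterTurn (measurePreserving_relabel)

/-! ## §A Measurability and probability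
(`measurable_obs`-type facts are also in the sibling file `…StubCouplingToLimitsEvents`, namespace
`CouplingToLimits`, landed during the same wave; kept here to stay import-independent.) -/

/-- The parity of the number of indices passing pointwise-measurable tests is measurable. [folklore] -/
theorem measurable_odd_card_filter {α ι : Type*} [MeasurableSpace α] {Q : ι → α → Prop}
    (hQ : ∀ i, Measurable (Q i)) (F : Finset ι) :
    Measurable fun a => Odd (F.filter fun i => Q i a).card := by
  classical
  induction F using Finset.induction_on with
  | empty => simp
  | insert i s hi ih =>
    have key : (fun a => Odd ((insert i s).filter fun j => Q j a).card) =
        fun a => Xor (Q i a) (Odd (s.filter fun j => Q j a).card) := by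
      funext a
      by_cases h : Q i a
      · rw [Finset.filter_insert, if_pos h, Finset.card_insert_of_notMem (by simp [hi]),
          Nat.odd_add_one]; grind
      · rw [Finset.filter_insert, if_neg h]; grind
    rw [key]
    exact ((hQ i).and ih.not).or (ih.and (hQ i).not)

/-- MEASURABILITY of the gauge observables: membership in the plaquette-parity set, the colour
field `blackSet S`, and `obs S = (blackSet S, antiSet S)` are measurable in the bits. [folklore] -/
theorem measurable_obs' (S : Set ℤ) : (∀ f : Site 2, Measurable fun ω : Ω => f ∈ parSet S ω) ∧
    Measurable (blackSet S) ∧ Measurable (obs S) := by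
  have hp : ∀ f : Site 2, Measurable fun ω : Ω => f ∈ parSet S ω := fun f =>
    (measurable_const.and ((measurable_set_mem f).comp
      (by fun_prop : Measurable fun ω : Ω => ω.2.2.1))).or
      (measurable_const.and ((measurable_set_mem f).comp
        (by fun_prop : Measurable fun ω : Ω => ω.2.2.2.1)))
  have hb : Measurable (blackSet S) := by
    refine measurable_set_iff.2 fun v => ?_
    have ha : Measurable fun ω : Ω => v 0 ∈ ω.1 := (measurable_set_mem (v 0)).comp measurable_fst
    have hb : Measurable fun ω : Ω => v 1 ∈ ω.2.1 :=
      (measurable_set_mem (v 1)).comp (measurable_fst.comp measurable_snd)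
    have hc := measurable_odd_card_filter (fun (f : ℤ × ℤ) => hp ![f.1, f.2])
      (Finset.Ico (min 0 (v 0)) (max 0 (v 0)) ×ˢ Finset.Ico (min 0 (v 1)) (max 0 (v 1)))
    have hx : ∀ {p q : Ω → Prop}, Measurable p → Measurable q →
        Measurable fun a => Xor (p a) (q a) := fun hp hq => (hp.and hq.not).or (hq.and hp.not)
    exact hx ha (hx hb hc)
  exact ⟨hp, hb, hb.prodMk (measurable_set_iff.2 fun f => measurable_const.or
    ((measurable_set_mem f).comp (by fun_prop : Measurable fun ω : Ω => ω.2.2.2.2)))⟩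

/-- The law of the observables is a probability measure. [folklore] -/
theorem isProbabilityMeasure_nuMix (S : Set ℤ) : IsProbabilityMeasure (νmix S) :=
  haveI : IsProbabilityMeasure μIK := by unfold μIK; infer_instance
  Measure.isProbabilityMeasure_map (measurable_obs' S).2.2.aemeasurable

/-- Vertical shifts of observables are measurable. [folklore] -/
theorem measurable_vshift (m : ℤ) : Measurable (vshift m) :=
  (measurable_set_iff.2 fun v => (measurable_set_mem (v - ![0, m])).comp measurable_fst).prodMk
    (measurable_set_iff.2 fun v => (measurable_set_mem (v - ![0, m])).comp measurable_snd)

/-- Vertical shifts of the fresh randomness are measurable. [folklore] -/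
theorem measurable_ushift (m : ℤ) : Measurable (ushift m) :=
  measurable_set_iff.2 fun q => measurable_set_mem (q.1 - ![0, m], q.2)

/-! ## §B Generic measure lemmas: fair-coin flips and swapped skew products -/

/-- At density `1/2`, flipping the states of a fixed set of sites preserves `P_{1/2}`. [folklore] -/
theorem sitePercolation_half_map_symmDiff {V : Type*} (D : Set V) :
    (sitePercolation V half).map (fun ω => ω ∆ D) = sitePercolation V half := by
  have hmeas : Measurable fun ω : Set V => ω ∆ D := measurable_set_iff.2 fun v => by
    simp only [Set.mem_symmDiff]
    exact ((measurable_set_mem v).and measurable_const).or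
      (measurable_const.and (measurable_set_mem v).not)
  have hX : Measurable fun χ : V → Prop => fun v => Xor (χ v) (v ∈ D) :=
    measurable_pi_lambda _ fun v => ((measurable_pi_apply v).and measurable_const.not).or
      (measurable_const.and (measurable_pi_apply v).not)
  rw [sitePercolation_eq_map, Measure.map_map hmeas measurable_setOf]
  have hcomp : (fun ω : Set V => ω ∆ D) ∘ (fun χ : V → Prop => {v | χ v}) =
      (fun χ : V → Prop => {v | χ v}) ∘ (fun χ : V → Prop => fun v => Xor (χ v) (v ∈ D)) := by
    funext χ; ext v; simp [Set.mem_symmDiff, Xor]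
  have hpi := Measure.infinitePi_map_pi (μ := fun _ : V => bernoulliProp half)
    (f := fun (v : V) (P : Prop) => Xor P (v ∈ D)) (fun v => measurable_of_finite _)
  have hfun : (fun v : V => (bernoulliProp half).map (fun P : Prop => Xor P (v ∈ D))) =
      fun _ => bernoulliProp half := by
    funext v
    by_cases hv : v ∈ D
    · have h1 : (fun P : Prop => Xor P (v ∈ D)) = Not := by funext P; grind
      have hσ : unitInterval.symm half = half := Subtype.ext (by simp [half]; norm_num)
      rw [h1, bernoulliProp, ProbabilityTheory.map_bernoulliMeasure' _ _ (measurable_of_finite _),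
        ProbabilityTheory.bernoulliMeasure_def, ProbabilityTheory.bernoulliMeasure_def, hσ,
        add_comm]
      simp
    · have h1 : (fun P : Prop => Xor P (v ∈ D)) = id := by funext P; grind
      rw [h1, Measure.map_id]
  rw [hcomp, ← Measure.map_map measurable_setOf hX, sitePi, hpi, hfun]

/-- A skew product acting on the FIRST factor fibrewise (driven by the second factor) and on the
second factor by a measure-preserving map preserves the product measure. [folklore] -/
theorem measurePreserving_swapSkew {α γ : Type*} [MeasurableSpace α] [MeasurableSpace γ]
    {μa : Measure α} {μc : Measure γ} [SFinite μa] [SFinite μc]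
    {F : α → α} (hF : MeasurePreserving F μa μa) {g : α → γ → γ}
    (hgm : Measurable (uncurry g)) (hg : ∀ a, (μc).map (g a) = μc) :
    MeasurePreserving (fun p : γ × α => (g p.2 p.1, F p.2)) (μc.prod μa) (μc.prod μa) := by
  have h1 := hF.skew_product (μc := μc) (μd := μc) hgm (Eventually.of_forall hg)
  have h2 : MeasurePreserving Prod.swap (μc.prod μa) (μa.prod μc) := Measure.measurePreserving_swap
  have h3 : MeasurePreserving Prod.swap (μa.prod μc) (μc.prod μa) := Measure.measurePreserving_swap
  exact h3.comp (h1.comp h2)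

/-! ## §C Parity bookkeeping for the anchored rectangles `Ico (min 0 z) (max 0 z)` -/

/-- Chasles relation modulo 2 for the unsigned interval sums `∑_{[min x y, max x y)}`. [folklore] -/
theorem sum_Ico_minmax_chasles (h : ℤ → ZMod 2) (x y z : ℤ) :
    ∑ b ∈ Finset.Ico (min x z) (max x z), h b =
      ∑ b ∈ Finset.Ico (min x y) (max x y), h b + ∑ b ∈ Finset.Ico (min y z) (max y z), h b := by
  have hc : ∀ a b c : ℤ, a ≤ b → b ≤ c → ∑ t ∈ Finset.Ico a c, h t =
      ∑ t ∈ Finset.Ico a b, h t + ∑ t ∈ Finset.Ico b c, h t := fun a b c hab hbc => by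
    rw [← Finset.Ico_union_Ico_eq_Ico hab hbc,
      Finset.sum_union (Finset.Ico_disjoint_Ico_consecutive a b c)]
  have fin : ∀ (u w : ZMod 2), (u = u + w + w) ∧ (u = w + u + w) ∧ (u = w + (w + u)) ∧
      (u = w + (u + w)) := by decide
  rcases le_total x y with hxy | hyx <;> rcases le_total y z with hyz | hzy
  · rw [min_eq_left hxy, max_eq_right hxy, min_eq_left hyz, max_eq_right hyz,
      min_eq_left (hxy.trans hyz), max_eq_right (hxy.trans hyz)]
    exact hc x y z hxy hyz
  · rw [min_eq_left hxy, max_eq_right hxy, min_eq_right hzy, max_eq_left hzy]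
    rcases le_total x z with hxz | hzx
    · rw [min_eq_left hxz, max_eq_right hxz, hc x z y hxz hzy]; exact (fin _ _).1
    · rw [min_eq_right hzx, max_eq_left hzx, hc z x y hzx hxy]; exact (fin _ _).2.2.2
  · rw [min_eq_right hyx, max_eq_left hyx, min_eq_left hyz, max_eq_right hyz]
    rcases le_total x z with hxz | hzx
    · rw [min_eq_left hxz, max_eq_right hxz, hc y x z hyx hxz]; exact (fin _ _).2.2.1
    · rw [min_eq_right hzx, max_eq_left hzx, hc y z x hyz hzx]; exact (fin _ _).2.1
  · rw [min_eq_right hyx, max_eq_left hyx, min_eq_right hzy, max_eq_left hzy,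
      min_eq_right (hzy.trans hyx), max_eq_left (hzy.trans hyx), add_comm]
    exact hc z y x hzy hyx

/-- Shifting the anchored rectangle `A × [min 0 y, max 0 y)` vertically by `m` changes the parity
of its marked points by that of the marked points of `A × [min 0 (-m), max 0 (-m))`. [folklore] -/
theorem odd_card_filter_shift (P : ℤ × ℤ → Prop) (A : Finset ℤ) (m y : ℤ) :
    Odd ((A ×ˢ Finset.Ico (min 0 y) (max 0 y)).filter (fun f => P (f.1, f.2 - m))).card ↔
      Xor (Odd ((A ×ˢ Finset.Ico (min 0 (y - m)) (max 0 (y - m))).filter P).card)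
        (Odd ((A ×ˢ Finset.Ico (min 0 (-m)) (max 0 (-m))).filter P).card) := by
  have cast : ∀ (s : Finset (ℤ × ℤ)) (Q : ℤ × ℤ → Prop), Odd (s.filter Q).card ↔
      (∑ f ∈ s, if Q f then (1 : ZMod 2) else 0) = 1 := fun s Q => by
    rw [← ZMod.natCast_eq_one_iff_odd, Finset.natCast_card_filter]
  have hx : ∀ a b : ZMod 2, Xor (a = 1) (b = 1) ↔ a + b = 1 := by decide
  rw [cast, cast, cast, hx]
  refine Eq.congr_left ?_
  rw [Finset.sum_product, Finset.sum_product, Finset.sum_product, ← Finset.sum_add_distrib]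
  refine Finset.sum_congr rfl fun a _ => ?_
  set h : ℤ → ZMod 2 := fun b => if P (a, b) then 1 else 0 with hh
  have hre : (∑ b ∈ Finset.Ico (min 0 y) (max 0 y),
      if P ((a, b).1, (a, b).2 - m) then (1 : ZMod 2) else 0) =
        ∑ b ∈ Finset.Ico (min (-m) (y - m)) (max (-m) (y - m)), h b := by
    have : Finset.Ico (min (-m) (y - m)) (max (-m) (y - m)) =
        (Finset.Ico (min 0 y) (max 0 y)).map (addRightEmbedding (-m)) := by
      rw [Finset.map_add_right_Ico, ← min_add_add_right, ← max_add_add_right, zero_add,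
        ← sub_eq_add_neg]
    rw [this, Finset.sum_map]
    simp [hh, sub_eq_add_neg]
  rw [hre, sum_Ico_minmax_chasles h (-m) 0 (y - m), min_comm (-m) 0, max_comm (-m) 0, add_comm]

/-! ## §D Vertical stationarity of `νmix S` (consistency of (i) with the sure covariance (iv)) -/

/-- RE-ANCHORING: a `μIK`-preserving map of the bit space lifting the vertical shift of the
observables (shift the row bits, plaquettes and coins; correct the column bits by the parity of
the plaquettes in the rectangles `[min 0 x, max 0 x) × [min 0 (-m), max 0 (-m))`). [folklore] -/
theorem exists_lift_vshift (S : Set ℤ) (m : ℤ) :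
    ∃ Φ : Ω → Ω, MeasurePreserving Φ μIK μIK ∧ ∀ ω, obs S (Φ ω) = vshift m (obs S ω) := by
  let τ : Set ℤ → Set ℤ := SiteConfig.relabel (Equiv.addRight m)
  let τ₂ : Set (Site 2) → Set (Site 2) := SiteConfig.relabel (Equiv.addRight ![0, m])
  let R : Type := Set ℤ × (Set (Site 2) × (Set (Site 2) × Set (Site 2)))
  let D : R → Set ℤ := fun br => {x | Odd ((Finset.Ico (min 0 x) (max 0 x) ×ˢ
      Finset.Ico (min 0 (-m)) (max 0 (-m))).filter
        (fun f : ℤ × ℤ => (![f.1, f.2] : Site 2) ∈ parSet S (((∅ : Set ℤ), br) : Ω))).card}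
  let F : R → R := fun br => (τ br.1, (τ₂ br.2.1, (τ₂ br.2.2.1, τ₂ br.2.2.2)))
  have hDm : ∀ x : ℤ, Measurable fun br : R => x ∈ D br := fun x =>
    measurable_odd_card_filter (fun (f : ℤ × ℤ) =>
      ((measurable_obs' S).1 ![f.1, f.2]).comp (measurable_const.prodMk measurable_id)) _
  have hgm : Measurable (uncurry fun (br : R) (a : Set ℤ) => a ∆ D br) := by
    refine measurable_set_iff.2 fun x => ?_
    simp only [uncurry, Set.mem_symmDiff]
    have ha : Measurable fun p : R × Set ℤ => x ∈ p.2 := (measurable_set_mem x).comp measurable_snd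
    have hd : Measurable fun p : R × Set ℤ => x ∈ D p.1 := (hDm x).comp measurable_fst
    exact (ha.and hd.not).or (hd.and ha.not)
  refine ⟨fun ω => (ω.1 ∆ D ω.2, F ω.2), ?_, fun ω => ?_⟩
  · unfold μIK
    exact measurePreserving_swapSkew ((measurePreserving_relabel _ _).prod
      ((measurePreserving_relabel _ _).prod ((measurePreserving_relabel _ _).prod
        (measurePreserving_relabel _ _)))) hgm fun br => sitePercolation_half_map_symmDiff (D br)
  · -- the intertwining identity
    have hrel : ∀ (P : Set (Site 2)) (f : Site 2), f ∈ τ₂ P ↔ f - ![0, m] ∈ P := fun P f => by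
      simp only [τ₂, SiteConfig.mem_relabel_iff, Equiv.addRight_symm, Equiv.coe_addRight,
        sub_eq_add_neg]
    have hrel1 : ∀ (b : Set ℤ) (y : ℤ), y ∈ τ b ↔ y - m ∈ b := fun b y => by
      simp only [τ, SiteConfig.mem_relabel_iff, Equiv.addRight_symm, Equiv.coe_addRight,
        sub_eq_add_neg]
    have hsub0 : ∀ f : Site 2, (f - ![0, m]) 0 = f 0 := fun f => by
      simp only [Pi.sub_apply, Matrix.cons_val_zero, sub_zero]
    have hsub1 : ∀ f : Site 2, (f - ![0, m]) 1 = f 1 - m := fun f => by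
      simp only [Pi.sub_apply, Matrix.cons_val_one, Matrix.cons_val_zero]
    have hvec : ∀ a b : ℤ, (![a, b] : Site 2) - ![0, m] = ![a, b - m] := fun a b => by
      simp only [Matrix.cons_sub_cons, Matrix.empty_sub_empty, sub_zero]
    have hpar : ∀ a b : ℤ, (![a, b] : Site 2) ∈ parSet S ((ω.1 ∆ D ω.2, F ω.2) : Ω) ↔
        (![a, b - m] : Site 2) ∈ parSet S ω := fun a b => by
      simp only [parSet, Set.mem_setOf_eq, F, hrel, hvec, Matrix.cons_val_zero]
    have hD : parSet S (((∅ : Set ℤ), ω.2) : Ω) = parSet S ω := rfl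
    refine Prod.ext ?_ ?_
    · ext v
      have key := odd_card_filter_shift (fun g : ℤ × ℤ => (![g.1, g.2] : Site 2) ∈ parSet S ω)
        (Finset.Ico (min 0 (v 0)) (max 0 (v 0))) m (v 1)
      dsimp only at key
      simp only [obs, vshift, Set.mem_preimage, blackSet, Set.mem_setOf_eq, hpar, hsub0, hsub1]
      simp only [F, hrel1, Set.mem_symmDiff, D, Set.mem_setOf_eq, hD]
      grind
    · ext f
      simp only [obs, vshift, Set.mem_preimage, antiSet, Set.mem_setOf_eq, F, hrel, hsub0]

/-- VERTICAL STATIONARITY: the law of the observables of the `S`-mixed model is invariant under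
vertical shifts (the gauge is anchored at row `0`, its LAW is not). Consistency of clause (i) of
`IsExchangeKernel` with the sure shift-covariance (iv). [folklore] -/
theorem nuMix_map_vshift : ∀ (S : Set ℤ) (m : ℤ), (νmix S).map (vshift m) = νmix S := by
  intro S m
  obtain ⟨Φ, hΦ, hobs⟩ := exists_lift_vshift S m
  rw [νmix, Measure.map_map (measurable_vshift m) (measurable_obs' S).2.2,
    show vshift m ∘ obs S = obs S ∘ Φ from funext fun ω => (hobs ω).symm,
    ← Measure.map_map (measurable_obs' S).2.2 hΦ.measurable, hΦ.map_eq]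

/-- The fresh randomness is stationary under vertical shifts as well. [folklore] -/
theorem beta_map_ushift (m : ℤ) : β.map (ushift m) = β := by
  have : ushift m = SiteConfig.relabel ((Equiv.addRight ![0, m]).prodCongr (Equiv.refl ℕ)) := by
    funext u; ext ⟨w, k⟩
    simp only [ushift, Set.mem_setOf_eq, SiteConfig.mem_relabel_iff, Equiv.prodCongr_symm,
      Equiv.refl_symm, Equiv.prodCongr_apply, Prod.map_apply, Equiv.addRight_symm,
      Equiv.coe_addRight, Equiv.coe_refl, id_eq, sub_eq_add_neg]
  rw [this, β, sitePercolation_map_relabel]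

/-! ## §E Colour-level exchange consistency (clauses (i)+(ii) of `IsExchangeKernel`) -/

/-- Swapping `i ↔ i+1` in a finite sum, mod 2: only an unmatched endpoint contributes. [folklore] -/
theorem sum_swap_add_sum (g : ℤ → ZMod 2) (i : ℤ) (A : Finset ℤ) :
    ∑ a ∈ A, (g (Equiv.swap i (i + 1) a) + g a) =
      if Xor (i ∈ A) (i + 1 ∈ A) then g i + g (i + 1) else 0 := by
  set F : ℤ → ZMod 2 := fun a => g (Equiv.swap i (i + 1) a) + g a with hF
  have h2 : ∀ u : ZMod 2, u + u = 0 := by decide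
  have hF0 : ∀ a, a ≠ i → a ≠ i + 1 → F a = 0 := fun a ha hb => by
    simp only [hF, Equiv.swap_apply_of_ne_of_ne ha hb, h2]
  have hFi : F i = g i + g (i + 1) := by simp only [hF, Equiv.swap_apply_left, add_comm]
  have hFi1 : F (i + 1) = g i + g (i + 1) := by simp only [hF, Equiv.swap_apply_right]
  have hrest : ∀ A' : Finset ℤ, i ∉ A' → i + 1 ∉ A' → ∑ a ∈ A', F a = 0 := fun A' ha hb =>
    Finset.sum_eq_zero fun a haA => hF0 a (fun h => ha (h ▸ haA)) (fun h => hb (h ▸ haA))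
  have hne : i + 1 ≠ i := by omega
  by_cases ha : i ∈ A <;> by_cases hb : i + 1 ∈ A
  · rw [← Finset.add_sum_erase A F ha, ← Finset.add_sum_erase (A.erase i) F
        (Finset.mem_erase.2 ⟨hne, hb⟩), hrest _ (by simp) (by simp), hFi, hFi1]
    simp [ha, hb, h2]
  · rw [← Finset.add_sum_erase A F ha, hrest _ (by simp) (by simp [hb]), hFi]; simp [ha, hb]
  · rw [← Finset.add_sum_erase A F hb, hrest _ (by simp [ha]) (by simp), hFi1]; simp [ha, hb]
  · rw [hrest A ha hb]; simp [ha, hb]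

/-- Swapping the columns `i, i+1` of the marks in an anchored rectangle `[min 0 x, max 0 x) × B`,
`x ≠ i+1`, preserves the parity of the number of marks, except in the anchor case `i = -1` where
it shifts it by the parity of the marks in `{i, i+1} × B`. [folklore] -/
theorem odd_card_filter_colSwap (P : ℤ × ℤ → Prop) (i x : ℤ) (hx : x ≠ i + 1) (B : Finset ℤ) :
    Odd ((Finset.Ico (min 0 x) (max 0 x) ×ˢ B).filter
        (fun f => P (Equiv.swap i (i + 1) f.1, f.2))).card ↔
      Xor (Odd ((Finset.Ico (min 0 x) (max 0 x) ×ˢ B).filter P).card)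
        (i = -1 ∧ Odd ((({i, i + 1} : Finset ℤ) ×ˢ B).filter P).card) := by
  have cast : ∀ (s : Finset (ℤ × ℤ)) (Q : ℤ × ℤ → Prop), Odd (s.filter Q).card ↔
      (∑ f ∈ s, if Q f then (1 : ZMod 2) else 0) = 1 := fun s Q => by
    rw [← ZMod.natCast_eq_one_iff_odd, Finset.natCast_card_filter]
  set g : ℤ → ZMod 2 := fun a => ∑ b ∈ B, if P (a, b) then 1 else 0 with hg
  have hne : i ≠ i + 1 := by omega
  have hmem : Xor (i ∈ Finset.Ico (min 0 x) (max 0 x)) (i + 1 ∈ Finset.Ico (min 0 x) (max 0 x)) ↔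
      i = -1 := by
    simp only [Finset.mem_Ico, xor_def]; omega
  have hcore := sum_swap_add_sum g i (Finset.Ico (min 0 x) (max 0 x))
  rw [Finset.sum_add_distrib] at hcore
  simp only [hmem] at hcore
  rw [cast, cast, cast, Finset.sum_product, Finset.sum_product, Finset.sum_product,
    Finset.sum_pair hne]
  change (∑ a ∈ Finset.Ico (min 0 x) (max 0 x), g (Equiv.swap i (i + 1) a)) = 1 ↔
    Xor ((∑ a ∈ Finset.Ico (min 0 x) (max 0 x), g a) = 1) (i = -1 ∧ g i + g (i + 1) = 1)
  have fin : ∀ (u w q : ZMod 2) (c : Prop) [Decidable c], u + w = (if c then q else 0) →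
      (u = 1 ↔ Xor (w = 1) (c ∧ q = 1)) := by
    intro u w q c _ huw
    by_cases hc : c <;> simp only [hc, if_true, if_false, true_and, false_and] at huw ⊢ <;>
      revert u w q <;> decide
  exact fin _ _ _ _ hcore

/-- COLUMN SWAP: for adjacent face columns `i, i+1` of different type, a `μIK`-preserving map of
the bit space under which the observables of the `S ∆ {i,i+1}`-model OFF cell column `i+1` / face
columns `i, i+1` are those of the `S`-model (swap the plaquette columns `i, i+1`; in the anchor
case `i = -1` correct the row bits). [folklore] -/
theorem exists_lift_colSwap (S : Set ℤ) (i : ℤ) (h : i ∈ S ↔ i + 1 ∉ S) :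
    ∃ Φ : Ω → Ω, MeasurePreserving Φ μIK μIK ∧ ∀ ω,
      (∀ v : Site 2, v 0 ≠ i + 1 → (v ∈ blackSet (S ∆ {i, i + 1}) (Φ ω) ↔ v ∈ blackSet S ω)) ∧
      (∀ f : Site 2, f 0 ≠ i → f 0 ≠ i + 1 →
        (f ∈ antiSet (S ∆ {i, i + 1}) (Φ ω) ↔ f ∈ antiSet S ω)) := by
  let s : ℤ → ℤ := Equiv.swap i (i + 1)
  let cs : Site 2 → Site 2 := fun v => ![s (v 0), v 1]
  have hcs : Function.Involutive cs := fun v => by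
    ext j; fin_cases j <;> simp [cs, s, Equiv.swap_apply_self]
  let σ : Set (Site 2) → Set (Site 2) := SiteConfig.relabel (hcs.toPerm cs)
  have hσ : ∀ (P : Set (Site 2)) (f : Site 2), f ∈ σ P ↔ cs f ∈ P := fun P f => by
    simp only [σ, SiteConfig.mem_relabel_iff, Function.Involutive.toPerm_symm,
      Function.Involutive.coe_toPerm]
  let R : Type := Set (Site 2) × (Set (Site 2) × Set (Site 2))
  let Db : R → Set ℤ := fun r => {y | i = -1 ∧ Odd (((({i, i + 1} : Finset ℤ)) ×ˢ
      Finset.Ico (min 0 y) (max 0 y)).filter (fun f : ℤ × ℤ =>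
        (![f.1, f.2] : Site 2) ∈ parSet S (((∅ : Set ℤ), ((∅ : Set ℤ), r)) : Ω))).card}
  let G : R → R := fun r => (σ r.1, (σ r.2.1, r.2.2))
  have hDm : ∀ y : ℤ, Measurable fun r : R => y ∈ Db r := fun y =>
    measurable_const.and (measurable_odd_card_filter (fun (f : ℤ × ℤ) =>
      ((measurable_obs' S).1 ![f.1, f.2]).comp
        (measurable_const.prodMk (measurable_const.prodMk measurable_id))) _)
  have hgm : Measurable (uncurry fun (r : R) (b : Set ℤ) => b ∆ Db r) := by
    refine measurable_set_iff.2 fun y => ?_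
    simp only [uncurry, Set.mem_symmDiff]
    have ha : Measurable fun p : R × Set ℤ => y ∈ p.2 := (measurable_set_mem y).comp measurable_snd
    have hd : Measurable fun p : R × Set ℤ => y ∈ Db p.1 := (hDm y).comp measurable_fst
    exact (ha.and hd.not).or (hd.and ha.not)
  refine ⟨fun ω => (ω.1, (ω.2.1 ∆ Db ω.2.2, G ω.2.2)), ?_,
    fun ω => ⟨fun v hv => ?_, fun f hf hf' => ?_⟩⟩
  · unfold μIK
    exact (MeasurePreserving.id _).prod (measurePreserving_swapSkew
      ((measurePreserving_relabel _ _).prod ((measurePreserving_relabel _ _).prod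
        (MeasurePreserving.id _))) hgm fun r => sitePercolation_half_map_symmDiff (Db r))
  · have hmemS : ∀ t : ℤ, t ∈ S ∆ ({i, i + 1} : Set ℤ) ↔ s t ∈ S := fun t => by
      simp only [s, Equiv.swap_apply_def, Set.mem_symmDiff, Set.mem_insert_iff,
        Set.mem_singleton_iff]
      split_ifs with h1 h2 <;> grind
    have hpar : ∀ a b : ℤ, (![a, b] : Site 2) ∈ parSet (S ∆ {i, i + 1})
        ((ω.1, (ω.2.1 ∆ Db ω.2.2, G ω.2.2)) : Ω) ↔ (![s a, b] : Site 2) ∈ parSet S ω := by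
      intro a b
      simp only [parSet, Set.mem_setOf_eq, G, hσ, cs, hmemS, Matrix.cons_val_zero,
        Matrix.cons_val_one]
    have hD : parSet S (((∅ : Set ℤ), ((∅ : Set ℤ), ω.2.2)) : Ω) = parSet S ω := rfl
    have key := odd_card_filter_colSwap (fun g : ℤ × ℤ => (![g.1, g.2] : Site 2) ∈ parSet S ω)
      i (v 0) hv (Finset.Ico (min 0 (v 1)) (max 0 (v 1)))
    dsimp only at key
    simp only [blackSet, Set.mem_setOf_eq, hpar]
    simp only [Set.mem_symmDiff, Db, Set.mem_setOf_eq, hD]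
    grind
  · have hS : f 0 ∉ S ∆ ({i, i + 1} : Set ℤ) ↔ f 0 ∉ S := by
      simp only [Set.mem_symmDiff, Set.mem_insert_iff, Set.mem_singleton_iff]; grind
    simp only [antiSet, Set.mem_setOf_eq, G, hS]

/-- COLOUR-LEVEL EXCHANGE CONSISTENCY: for adjacent face columns `i, i+1` of different type, every
measurable event of observables not reading the colours of cell column `i+1` nor the diagonals of
face columns `i, i+1` has the same probability in the `S`- and the `S ∆ {i,i+1}`-mixed models:
the necessary condition that clauses (i) (law transport) and (ii) (nothing else changes) of
`IsExchangeKernel` impose jointly (honeycomb column kernel = all-ones matrix). [folklore] -/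
theorem nuMix_symmDiff_apply_eq : ∀ (S : Set ℤ) (i : ℤ), (i ∈ S ↔ i + 1 ∉ S) →
    ∀ (E : Set Obs), MeasurableSet E →
      (∀ x y : Obs, (∀ v : Site 2, v 0 ≠ i + 1 → (v ∈ x.1 ↔ v ∈ y.1)) →
        (∀ f : Site 2, f 0 ≠ i → f 0 ≠ i + 1 → (f ∈ x.2 ↔ f ∈ y.2)) → (x ∈ E ↔ y ∈ E)) →
      νmix (symmDiff S {i, i + 1}) E = νmix S E := by
  intro S i h E hE hoff
  obtain ⟨Φ, hΦ, hobs⟩ := exists_lift_colSwap S i h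
  rw [νmix, νmix, Measure.map_apply (measurable_obs' _).2.2 hE, Measure.map_apply
    (measurable_obs' _).2.2 hE, ← hΦ.map_eq, Measure.map_apply hΦ.measurable
    ((measurable_obs' _).2.2 hE), hΦ.map_eq]
  congr 1; ext ω
  exact hoff (obs (S ∆ {i, i + 1}) (Φ ω)) (obs S ω) (hobs ω).1 (hobs ω).2

end Summit.CriticalPhenomena.CardyFormulaZ2.Theorems.IKLinearTransport.PinnedDiagramExchange
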